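import Summits.CriticalPhenomena.PercolationContinuityZ3.Theorems.PercNearOneGluingNoHeavyQuantBlockCombGeneralRow
import Summits.CriticalPhenomena.PercolationContinuityZ3.Theorems.PercNearOneGluingNoHeavyQuantBlockCombLightMerge
import HarnessLib

/-!
# QUANT lane R8, FAR on trees beyond block-combs: the TWO-RELAY HAIR row (mixture principle, canonical form)

builds on p205010 (kernel theorem, internal audit signed; external expert review pending)

Support file (`--supports stmt-CriticalPhenomena-4575`), QUANT lane seat prim-quant-census-1 (gen 13); memo
`run/shared/lean/prim/quant/prim-quant-census-1/GENERAL-ROW-G13.md` §7.  Theorems only, no sorries, standard axioms; model of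
`…QuantBlockCombMergeModel.lean`.  A TWO-RELAY HAIR at chain level `l` (unit relay `u`, gate `p`; below it a unit relay, gate `r`) is not a
block-comb side structure.  Conditioning on its two gates, the tail of 'block-comb + hair' is `(1 − p)·T₀ + p(1 − r)·T₁ + p r·T₂`, `T_h` = the
canonical tail with a SURE blob of size `h` at level `l`.  MIXTURE PRINCIPLE: the hair law `(1 − p, p(1 − r), p r)` is the mean-preserving
mixture `λ·[independent units p, p r] + (1 − λ)·[block of size 2, gate p(1+r)/2]`; both components are block-combs with marginals above the
floor and the same mean, so `tail_ge_of_mean` (p247138) for the two components gives the hair row.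
* `Quant.BlockComb.tail_gate_split` — `TAIL[a, g] = g s·TAIL[a, g[s ↦ 1]] + (1 − g s)·TAIL[a[s ↦ 0], g]`.
* `Quant.BlockComb.tail_sure_transfer` — two SURE blobs at the same level merge (sizes add) without changing the tail.
* `Quant.BlockComb.tail_ge_of_mean_hair` — **THEOREM (block-comb + one two-relay hair)**: floor `x = ∏ q > 0`, live marginals `≥ x`, two
  spare dead indices `u ≠ β` at a common level `≤ D`, hair gates `p, r ∈ [0,1]` with `(∏_{i<lv u} q)·p·r ≥ x`, budget
  `2j < Σ a·marginal + (∏_{i<lv u} q)·(p + p r)` ⟹ `x ≤ (1 − p)·TAIL[a, g[u↦1]] + p(1 − r)·TAIL[a[u↦1], g[u↦1]] + p r·TAIL[a[u↦2], g[u↦1]]`.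
  (Transport: two gate splits identify the right side with `P(#reached ≥ j+1)` of 'presentation + a hair at chain vertex l'.)
-/


namespace Summit.CriticalPhenomena.PercolationContinuityZ3.Theorems

namespace Quant

namespace BlockComb

open Finset

variable {κ : Type*} [Fintype κ] [DecidableEq κ]

/-- product-Bernoulli weight of the set `S` of open blob gates -/
local notation3 "wt[" g ", " S "]" => ∏ k, (if k ∈ (S : Finset κ) then (g : κ → ℝ) k else 1 - (g : κ → ℝ) k)

/-- the same weight with the gate of `s` removed -/
local notation3 "wt'[" g ", " s ", " S "]" =>
  ∏ k ∈ (Finset.univ : Finset κ).erase s, (if k ∈ (S : Finset κ) then (g : κ → ℝ) k else 1 - (g : κ → ℝ) k)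

/-- probability that the chain `q` of length `D` is open exactly to depth `i` -/
local notation3 "pd[" D ", " q ", " i "]" =>
  (∏ i' ∈ Finset.range (i : ℕ), (q : ℕ → ℝ) i') * (if (i : ℕ) < (D : ℕ) then 1 - (q : ℕ → ℝ) i else 1)

/-- mass counted at depth `i` in blob configuration `S` -/
local notation3 "mass[" lv ", " a ", " i ", " S "]" =>
  ∑ k ∈ (S : Finset κ).filter (fun k => (lv : κ → ℕ) k ≤ (i : ℕ)), ((a : κ → ℕ) k : ℕ)

/-- the tail `P(N ≥ j+1)` of the block-comb count, as an explicit finite sum -/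
local notation3 "TAIL[" D ", " q ", " lv ", " a ", " g ", " j "]" =>
  ∑ i ∈ Finset.range ((D : ℕ) + 1), pd[D, q, i] *
    ∑ S : Finset κ, wt[g, S] * (if (j : ℕ) + 1 ≤ mass[lv, a, i, S] then (1 : ℝ) else 0)

/-- **Gate split.**  `TAIL[a, g] = g s·TAIL[a, g[s ↦ 1]] + (1 − g s)·TAIL[a[s ↦ 0], g]`: condition on the private gate of `s`
(open: `s` is a sure blob; closed: `s` is dead). [folklore] -/
theorem tail_gate_split (D : ℕ) (q : ℕ → ℝ) (lv : κ → ℕ) (a : κ → ℕ) (g : κ → ℝ) (j : ℕ) (s : κ) :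
    TAIL[D, q, lv, a, g, j] =
      g s * TAIL[D, q, lv, a, Function.update g s 1, j] +
        (1 - g s) * TAIL[D, q, lv, Function.update a s 0, g, j] := by
  rw [Finset.mul_sum, Finset.mul_sum, ← Finset.sum_add_distrib]
  refine Finset.sum_congr rfl fun i _ => ?_
  -- the three configuration sums, split at the gate of `s`
  rw [sum_wt_split g s, sum_wt_split (Function.update g s 1) s, sum_wt_split g s
    (fun S => (if j + 1 ≤ mass[lv, Function.update a s 0, i, S] then (1 : ℝ) else 0))]
  rw [mul_left_comm (g s), mul_left_comm (1 - g s), ← mul_add]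
  congr 1
  rw [Finset.mul_sum, Finset.mul_sum, ← Finset.sum_add_distrib]
  refine Finset.sum_congr rfl fun S _ => ?_
  by_cases hsS : s ∈ S
  · simp only [if_pos hsS, mul_zero, add_zero]
  · rw [if_neg hsS, if_neg hsS, if_neg hsS, wt'_update, Function.update_self,
      mass_insert_dead lv (Function.update a s 0) s i S (Function.update_self ..),
      mass_update_of_notMem lv a s 0 i S hsS]
    ring

omit [Fintype κ] in
/-- Moving the size of `β` onto `u` does not change the mass of a configuration containing both, when they sit at the same level.
[folklore] -/
theorem mass_sure_transfer (lv : κ → ℕ) (a : κ → ℕ) (u β : κ) (huβ : u ≠ β) (hl : lv β = lv u) (i : ℕ) (S : Finset κ)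
    (hu : u ∈ S) (hβ : β ∈ S) :
    mass[lv, Function.update (Function.update a β 0) u (a u + a β), i, S] = mass[lv, a, i, S] := by
  set a' := Function.update (Function.update a β 0) u (a u + a β) with ha'
  by_cases hli : lv u ≤ i
  · have huT : u ∈ S.filter (fun k => lv k ≤ i) := Finset.mem_filter.2 ⟨hu, hli⟩
    have hβT : β ∈ S.filter (fun k => lv k ≤ i) := Finset.mem_filter.2 ⟨hβ, by rw [hl]; exact hli⟩
    have hβT' : β ∈ (S.filter (fun k => lv k ≤ i)) \ {u} := by
      rw [Finset.mem_sdiff, Finset.mem_singleton]; exact ⟨hβT, huβ.symm⟩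
    show (∑ k ∈ S.filter (fun k => lv k ≤ i), a' k) = ∑ k ∈ S.filter (fun k => lv k ≤ i), a k
    rw [Finset.sum_eq_add_sum_sdiff_singleton_of_mem huT, Finset.sum_eq_add_sum_sdiff_singleton_of_mem hβT',
      Finset.sum_eq_add_sum_sdiff_singleton_of_mem huT a, Finset.sum_eq_add_sum_sdiff_singleton_of_mem hβT' a]
    have h1 : a' u = a u + a β := by rw [ha', Function.update_self]
    have h2 : a' β = 0 := by rw [ha', Function.update_of_ne huβ.symm, Function.update_self]
    have h3 : ∑ k ∈ (((S.filter (fun k => lv k ≤ i)) \ {u}) \ {β}), a' k =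
        ∑ k ∈ (((S.filter (fun k => lv k ≤ i)) \ {u}) \ {β}), a k := by
      refine Finset.sum_congr rfl fun k hk => ?_
      rw [Finset.mem_sdiff, Finset.mem_sdiff, Finset.mem_singleton, Finset.mem_singleton] at hk
      rw [ha', Function.update_of_ne hk.1.2, Function.update_of_ne hk.2]
    rw [h1, h2, h3]
    ring
  · have huT : u ∉ S.filter (fun k => lv k ≤ i) := fun h => hli (Finset.mem_filter.1 h).2
    have hβT : β ∉ S.filter (fun k => lv k ≤ i) := fun h => hli (by rw [← hl]; exact (Finset.mem_filter.1 h).2)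
    refine Finset.sum_congr rfl fun k hk => ?_
    have hku : k ≠ u := fun h => huT (h ▸ hk)
    have hkβ : k ≠ β := fun h => hβT (h ▸ hk)
    rw [ha', Function.update_of_ne hku, Function.update_of_ne hkβ]

/-- **Sure blobs at a common level merge.**  If `g u = 1`, `g β = 1`, `lv β = lv u` and `u ≠ β`, then moving the size of `β` onto `u`
leaves the tail unchanged (configurations missing a sure blob have weight `0`). [folklore] -/
theorem tail_sure_transfer (D : ℕ) (q : ℕ → ℝ) (lv : κ → ℕ) (a : κ → ℕ) (g : κ → ℝ) (j : ℕ) (u β : κ) (huβ : u ≠ β)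
    (hl : lv β = lv u) (hu : g u = 1) (hβ : g β = 1) :
    TAIL[D, q, lv, a, g, j] = TAIL[D, q, lv, Function.update (Function.update a β 0) u (a u + a β), g, j] := by
  refine Finset.sum_congr rfl fun i _ => ?_
  congr 1
  refine Finset.sum_congr rfl fun S _ => ?_
  by_cases huS : u ∈ S
  · by_cases hβS : β ∈ S
    · rw [mass_sure_transfer lv a u β huβ hl i S huS hβS]
    · have h0 : wt[g, S] = 0 := Finset.prod_eq_zero (Finset.mem_univ β) (by rw [if_neg hβS, hβ, sub_self])
      rw [h0, zero_mul, zero_mul]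
  · have h0 : wt[g, S] = 0 := Finset.prod_eq_zero (Finset.mem_univ u) (by rw [if_neg huS, hu, sub_self])
    rw [h0, zero_mul, zero_mul]

/-- **THEOREM (FAR for a block-comb plus one two-relay hair, canonical form).**  Floor `x = ∏_{i<D} q i > 0`; live levels `≤ D`, live
marginals `≥ x`; two spare DEAD indices `u ≠ β` at a common level `≤ D`; hair gates `p, r ∈ [0,1]` with bottom marginal `(∏_{i<lv u} q i)·p·r ≥ x`;
budget `2j < Σ_k a k·marginal k + (∏_{i<lv u} q i)·(p + p·r)`.  Then the hair tail (sure blob of size `0/1/2` at level `lv u` in place of the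
hair, weighted `(1 − p) / p(1 − r) / p r`) is at least `x`.  Proof: mixture principle + `tail_ge_of_mean` for the two components. [this work] -/
theorem tail_ge_of_mean_hair (D : ℕ) (q : ℕ → ℝ) (hq : ∀ i, 0 ≤ q i ∧ q i ≤ 1) (lv : κ → ℕ) (a : κ → ℕ)
    (g : κ → ℝ) (hg : ∀ k, 0 ≤ g k ∧ g k ≤ 1) (j : ℕ) (hlv : ∀ k, 0 < a k → lv k ≤ D)
    (u β : κ) (huβ : u ≠ β) (hlu : lv u ≤ D) (hlβ : lv β = lv u) (hau : a u = 0) (haβ : a β = 0)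
    (p r : ℝ) (hp : 0 ≤ p ∧ p ≤ 1) (hr : 0 ≤ r ∧ r ≤ 1)
    (x : ℝ) (hx0 : 0 < x) (hxq : x = ∏ i ∈ Finset.range D, q i)
    (hmarg : ∀ k, 0 < a k → x ≤ (∏ i ∈ Finset.range (lv k), q i) * g k)
    (hhair : x ≤ (∏ i ∈ Finset.range (lv u), q i) * (p * r))
    (hbudget : (2 * j : ℝ) < ∑ k, (a k : ℝ) * ((∏ i ∈ Finset.range (lv k), q i) * g k) +
      (∏ i ∈ Finset.range (lv u), q i) * (p + p * r)) :
    x ≤ (1 - p) * TAIL[D, q, lv, a, Function.update g u 1, j] +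
        p * (1 - r) * TAIL[D, q, lv, Function.update a u 1, Function.update g u 1, j] +
        p * r * TAIL[D, q, lv, Function.update a u 2, Function.update g u 1, j] := by
  -- abbreviations
  set P : ℝ := ∏ i ∈ Finset.range (lv u), q i with hP
  have hP01 : 0 ≤ P ∧ P ≤ 1 := prefixProd_mem q hq (lv u)
  set T0 : ℝ := TAIL[D, q, lv, a, Function.update g u 1, j] with hT0
  set T1 : ℝ := TAIL[D, q, lv, Function.update a u 1, Function.update g u 1, j] with hT1
  set T2 : ℝ := TAIL[D, q, lv, Function.update a u 2, Function.update g u 1, j] with hT2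
  have hT0' : TAIL[D, q, lv, a, g, j] = T0 := by rw [hT0, tail_update_dead D q lv a g j u 1 hau]
  -- useful function identities
  have hβu : β ≠ u := huβ.symm
  -- ### component B: one block of size 2 and gate `g₂ = p(1+r)/2` at level `lv u`
  set g₂ : ℝ := p * (1 + r) / 2 with hg₂
  have hg₂01 : 0 ≤ g₂ ∧ g₂ ≤ 1 := by
    refine ⟨by rw [hg₂]; nlinarith [hp.1, hr.1], ?_⟩
    rw [hg₂]; nlinarith [hp.2, hr.2, hp.1, hr.1]
  have hpr_le_g₂ : p * r ≤ g₂ := by rw [hg₂]; nlinarith [hp.1, hr.1, hr.2]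
  set aB : κ → ℕ := Function.update a u 2 with haB
  set gB : κ → ℝ := Function.update g u g₂ with hgB
  have hgB01 : ∀ k, 0 ≤ gB k ∧ gB k ≤ 1 := by
    intro k; by_cases hk : k = u
    · subst hk; rw [hgB, Function.update_self]; exact hg₂01
    · rw [hgB, Function.update_of_ne hk]; exact hg k
  have hliveB : ∀ k, 0 < aB k → k = u ∨ 0 < a k := by
    intro k hk; by_cases hku : k = u
    · exact Or.inl hku
    · rw [haB, Function.update_of_ne hku] at hk; exact Or.inr hk
  have hlvB : ∀ k, 0 < aB k → lv k ≤ D := by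
    intro k hk; rcases hliveB k hk with rfl | h
    · exact hlu
    · exact hlv k h
  have hmargB : ∀ k, 0 < aB k → x ≤ (∏ i ∈ Finset.range (lv k), q i) * gB k := by
    intro k hk; rcases hliveB k hk with rfl | h
    · rw [hgB, Function.update_self]
      exact hhair.trans (mul_le_mul_of_nonneg_left hpr_le_g₂ hP01.1)
    · by_cases hku : k = u
      · subst hku; rw [hau] at h; exact absurd h (lt_irrefl 0)
      · rw [hgB, Function.update_of_ne hku]; exact hmarg k h
  have hmeanB : ∑ k, (aB k : ℝ) * ((∏ i ∈ Finset.range (lv k), q i) * gB k) =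
      ∑ k, (a k : ℝ) * ((∏ i ∈ Finset.range (lv k), q i) * g k) + P * (p + p * r) := by
    rw [Finset.sum_eq_add_sum_sdiff_singleton_of_mem (Finset.mem_univ u),
      Finset.sum_eq_add_sum_sdiff_singleton_of_mem (Finset.mem_univ u) (fun k => (a k : ℝ) * _)]
    have hrest : ∑ k ∈ ((Finset.univ : Finset κ) \ {u}), (aB k : ℝ) * ((∏ i ∈ Finset.range (lv k), q i) * gB k) =
        ∑ k ∈ ((Finset.univ : Finset κ) \ {u}), (a k : ℝ) * ((∏ i ∈ Finset.range (lv k), q i) * g k) := by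
      refine Finset.sum_congr rfl fun k hk => ?_
      have hku : k ≠ u := fun h => by rw [Finset.mem_sdiff, Finset.mem_singleton] at hk; exact hk.2 h
      rw [haB, hgB, Function.update_of_ne hku, Function.update_of_ne hku]
    rw [hrest, haB, hgB, Function.update_self, Function.update_self, hau, ← hP, hg₂]
    push_cast
    ring
  have hbudgetB : (2 * j : ℝ) < ∑ k, (aB k : ℝ) * ((∏ i ∈ Finset.range (lv k), q i) * gB k) := by
    rw [hmeanB]; exact hbudget
  have hfarB : x ≤ TAIL[D, q, lv, aB, gB, j] := tail_ge_of_mean D q hq lv aB gB hgB01 j hlvB x hx0 hxq hmargB hbudgetB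
  -- expansion of component B: `TAIL_B = g₂·T2 + (1 − g₂)·T0`
  have heB : TAIL[D, q, lv, aB, gB, j] = g₂ * T2 + (1 - g₂) * T0 := by
    rw [tail_gate_split D q lv aB gB j u]
    have h1 : gB u = g₂ := by rw [hgB, Function.update_self]
    have h2 : Function.update gB u 1 = Function.update g u 1 := by rw [hgB, Function.update_idem]
    have h3 : Function.update aB u 0 = a := by rw [haB, Function.update_idem]; exact Function.update_eq_self_iff.2 hau.symm
    rw [h1, h2, h3, hgB, tail_update_dead D q lv a g j u g₂ hau, hT0']
  -- ### component U: two independent units of gates `p` and `p·r` at level `lv u`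
  set aU : κ → ℕ := Function.update (Function.update a u 1) β 1 with haU
  set gU : κ → ℝ := Function.update (Function.update g u p) β (p * r) with hgU
  have hpr01 : 0 ≤ p * r ∧ p * r ≤ 1 := ⟨mul_nonneg hp.1 hr.1, mul_le_one₀ hp.2 hr.1 hr.2⟩
  have hgU01 : ∀ k, 0 ≤ gU k ∧ gU k ≤ 1 := by
    intro k
    by_cases hkβ : k = β
    · subst hkβ; rw [hgU, Function.update_self]; exact hpr01
    · by_cases hku : k = u
      · subst hku; rw [hgU, Function.update_of_ne hkβ, Function.update_self]; exact hp
      · rw [hgU, Function.update_of_ne hkβ, Function.update_of_ne hku]; exact hg k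
  have hliveU : ∀ k, 0 < aU k → k = u ∨ k = β ∨ 0 < a k := by
    intro k hk
    by_cases hkβ : k = β
    · exact Or.inr (Or.inl hkβ)
    · by_cases hku : k = u
      · exact Or.inl hku
      · rw [haU, Function.update_of_ne hkβ, Function.update_of_ne hku] at hk; exact Or.inr (Or.inr hk)
  have hlvU : ∀ k, 0 < aU k → lv k ≤ D := by
    intro k hk; rcases hliveU k hk with rfl | rfl | h
    · exact hlu
    · rw [hlβ]; exact hlu
    · exact hlv k h
  have hmargU : ∀ k, 0 < aU k → x ≤ (∏ i ∈ Finset.range (lv k), q i) * gU k := by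
    intro k hk; rcases hliveU k hk with rfl | rfl | h
    · rw [hgU, Function.update_of_ne huβ, Function.update_self]
      calc x ≤ P * (p * r) := hhair
        _ ≤ P * p := by
            refine mul_le_mul_of_nonneg_left ?_ hP01.1
            exact mul_le_of_le_one_right hp.1 hr.2
    · rw [hgU, Function.update_self, hlβ]; exact hhair
    · by_cases hkβ : k = β
      · subst hkβ; rw [haβ] at h; exact absurd h (lt_irrefl 0)
      · by_cases hku : k = u
        · subst hku; rw [hau] at h; exact absurd h (lt_irrefl 0)
        · rw [hgU, Function.update_of_ne hkβ, Function.update_of_ne hku]; exact hmarg k h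
  have hmeanU : ∑ k, (aU k : ℝ) * ((∏ i ∈ Finset.range (lv k), q i) * gU k) =
      ∑ k, (a k : ℝ) * ((∏ i ∈ Finset.range (lv k), q i) * g k) + P * (p + p * r) := by
    have hβmem : β ∈ (Finset.univ : Finset κ) \ {u} := by
      rw [Finset.mem_sdiff, Finset.mem_singleton]; exact ⟨Finset.mem_univ _, hβu⟩
    rw [Finset.sum_eq_add_sum_sdiff_singleton_of_mem (Finset.mem_univ u),
      Finset.sum_eq_add_sum_sdiff_singleton_of_mem hβmem,
      Finset.sum_eq_add_sum_sdiff_singleton_of_mem (Finset.mem_univ u) (fun k => (a k : ℝ) * _),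
      Finset.sum_eq_add_sum_sdiff_singleton_of_mem hβmem (fun k => (a k : ℝ) * _)]
    have hrest : ∑ k ∈ (((Finset.univ : Finset κ) \ {u}) \ {β}), (aU k : ℝ) * ((∏ i ∈ Finset.range (lv k), q i) * gU k) =
        ∑ k ∈ (((Finset.univ : Finset κ) \ {u}) \ {β}), (a k : ℝ) * ((∏ i ∈ Finset.range (lv k), q i) * g k) := by
      refine Finset.sum_congr rfl fun k hk => ?_
      rw [Finset.mem_sdiff, Finset.mem_sdiff, Finset.mem_singleton, Finset.mem_singleton] at hk
      rw [haU, hgU, Function.update_of_ne hk.2, Function.update_of_ne hk.1.2, Function.update_of_ne hk.2,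
        Function.update_of_ne hk.1.2]
    rw [hrest, haU, hgU, Function.update_of_ne huβ, Function.update_self, Function.update_self,
      Function.update_of_ne huβ, Function.update_self, Function.update_self, hau, haβ, hlβ, ← hP]
    push_cast
    ring
  have hbudgetU : (2 * j : ℝ) < ∑ k, (aU k : ℝ) * ((∏ i ∈ Finset.range (lv k), q i) * gU k) := by
    rw [hmeanU]; exact hbudget
  have hfarU : x ≤ TAIL[D, q, lv, aU, gU, j] := tail_ge_of_mean D q hq lv aU gU hgU01 j hlvU x hx0 hxq hmargU hbudgetU
  -- expansion of component U: `TAIL_U = p·r·(p·T2 + (1 − p)·T1) + (1 − p·r)·(p·T1 + (1 − p)·T0)`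
  have heU : TAIL[D, q, lv, aU, gU, j] = p * r * (p * T2 + (1 - p) * T1) + (1 - p * r) * (p * T1 + (1 - p) * T0) := by
    -- split at `β`
    rw [tail_gate_split D q lv aU gU j β]
    have hgUβ : gU β = p * r := by rw [hgU, Function.update_self]
    have hgU1 : Function.update gU β 1 = Function.update (Function.update g u p) β 1 := by rw [hgU, Function.update_idem]
    have haU0 : Function.update aU β 0 = Function.update a u 1 := by
      rw [haU, Function.update_idem]
      exact Function.update_eq_self_iff.2 (by rw [Function.update_of_ne hβu, haβ])
    rw [hgUβ, hgU1, haU0]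
    -- the `β`-closed branch: `TAIL[a[u↦1], gU] = p·T1 + (1 − p)·T0`
    have hclosed : TAIL[D, q, lv, Function.update a u 1, gU, j] = p * T1 + (1 - p) * T0 := by
      have hdeadβ : Function.update a u 1 β = 0 := by rw [Function.update_of_ne hβu, haβ]
      have ha0 : Function.update a u 0 = a := Function.update_eq_self_iff.2 hau.symm
      rw [hgU, tail_update_dead D q lv (Function.update a u 1) (Function.update g u p) j β (p * r) hdeadβ,
        tail_gate_split D q lv (Function.update a u 1) (Function.update g u p) j u, Function.update_self,
        Function.update_idem, Function.update_idem, ha0, tail_update_dead D q lv a g j u p hau, hT0']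
    -- the `β`-open branch: `TAIL[aU, g[u↦p][β↦1]] = p·T2 + (1 − p)·T1`
    have hopen : TAIL[D, q, lv, aU, Function.update (Function.update g u p) β 1, j] = p * T2 + (1 - p) * T1 := by
      rw [tail_gate_split D q lv aU (Function.update (Function.update g u p) β 1) j u]
      have hgu : Function.update (Function.update g u p) β 1 u = p := by
        rw [Function.update_of_ne huβ, Function.update_self]
      rw [hgu]
      -- both sure: merge `β` into `u` (sizes 1 + 1 = 2), then forget the gate of the dead `β`
      have hG : Function.update (Function.update (Function.update g u p) β 1) u 1 =
          Function.update (Function.update g u 1) β 1 := by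
        rw [Function.update_comm huβ, Function.update_idem, Function.update_comm hβu]
      have hboth : TAIL[D, q, lv, aU, Function.update (Function.update (Function.update g u p) β 1) u 1, j] = T2 := by
        rw [hG, tail_sure_transfer D q lv aU (Function.update (Function.update g u 1) β 1) j u β huβ hlβ
          (by rw [Function.update_of_ne huβ, Function.update_self]) (Function.update_self ..)]
        have hsz : Function.update (Function.update aU β 0) u (aU u + aU β) = Function.update a u 2 := by
          rw [haU]
          ext k
          by_cases hku : k = u
          · subst hku
            rw [Function.update_self, Function.update_of_ne huβ, Function.update_self, Function.update_self,
              Function.update_self]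
          · rw [Function.update_of_ne hku, Function.update_of_ne hku]
            by_cases hkβ : k = β
            · subst hkβ; rw [Function.update_self, haβ]
            · rw [Function.update_of_ne hkβ, Function.update_of_ne hkβ, Function.update_of_ne hku]
        rw [hsz]
        have hdeadβ : Function.update a u 2 β = 0 := by rw [Function.update_of_ne hβu, haβ]
        rw [tail_update_dead D q lv (Function.update a u 2) (Function.update g u 1) j β 1 hdeadβ]
      -- `u` closed, `β` sure of size 1: relabel `β` as `u`
      have honly : TAIL[D, q, lv, Function.update aU u 0, Function.update (Function.update g u p) β 1, j] = T1 := by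
        have ha1 : Function.update aU u 0 = Function.update a β 1 := by
          rw [haU]
          ext k
          by_cases hku : k = u
          · subst hku; rw [Function.update_self, Function.update_of_ne huβ, hau]
          · rw [Function.update_of_ne hku]
            by_cases hkβ : k = β
            · subst hkβ; rw [Function.update_self, Function.update_self]
            · rw [Function.update_of_ne hkβ, Function.update_of_ne hku, Function.update_of_ne hkβ]
        rw [ha1]
        -- forget the gate of the dead `u`, make it sure instead, and transfer `β` onto `u`
        have hdeadu : Function.update a β 1 u = 0 := by rw [Function.update_of_ne huβ, hau]
        have hG' : Function.update (Function.update g u p) β 1 = Function.update (Function.update g β 1) u p :=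
          Function.update_comm huβ p 1 g
        have hsz : Function.update (Function.update (Function.update a β 1) β 0) u
            (Function.update a β 1 u + Function.update a β 1 β) = Function.update a u 1 := by
          ext k
          by_cases hku : k = u
          · subst hku; rw [Function.update_self, Function.update_self, Function.update_of_ne huβ, Function.update_self, hau]
          · rw [Function.update_of_ne hku, Function.update_of_ne hku]
            by_cases hkβ : k = β
            · subst hkβ; rw [Function.update_self, haβ]
            · rw [Function.update_of_ne hkβ, Function.update_of_ne hkβ]
        have hdeadβ : Function.update a u 1 β = 0 := by rw [Function.update_of_ne hβu, haβ]
        calc TAIL[D, q, lv, Function.update a β 1, Function.update (Function.update g u p) β 1, j]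
            = TAIL[D, q, lv, Function.update a β 1, Function.update g β 1, j] := by
              rw [hG', tail_update_dead D q lv (Function.update a β 1) (Function.update g β 1) j u p hdeadu]
          _ = TAIL[D, q, lv, Function.update a β 1, Function.update (Function.update g β 1) u 1, j] :=
              (tail_update_dead D q lv (Function.update a β 1) (Function.update g β 1) j u 1 hdeadu).symm
          _ = TAIL[D, q, lv, Function.update a u 1, Function.update (Function.update g β 1) u 1, j] := by
              rw [tail_sure_transfer D q lv (Function.update a β 1) (Function.update (Function.update g β 1) u 1) j u β
                huβ hlβ (Function.update_self ..) (by rw [Function.update_of_ne hβu, Function.update_self]), hsz]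
          _ = TAIL[D, q, lv, Function.update a u 1, Function.update (Function.update g u 1) β 1, j] := by
              rw [Function.update_comm hβu]
          _ = T1 := by
              rw [tail_update_dead D q lv (Function.update a u 1) (Function.update g u 1) j β 1 hdeadβ]
      rw [hboth, honly]
    rw [hopen, hclosed]
  -- ### the mixture identity and the conclusion
  set TU : ℝ := TAIL[D, q, lv, aU, gU, j] with hTU
  set TB : ℝ := TAIL[D, q, lv, aB, gB, j] with hTB
  set H : ℝ := (1 - p) * T0 + p * (1 - r) * T1 + p * r * T2 with hH
  have key : (g₂ - p ^ 2 * r) * H = (g₂ - p * r) * TU + (p * r - p ^ 2 * r) * TB := by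
    rw [hH, heU, heB, hg₂]
    ring
  have hc1 : 0 ≤ g₂ - p * r := sub_nonneg.2 hpr_le_g₂
  have hc2 : 0 ≤ p * r - p ^ 2 * r := by nlinarith [hp.1, hp.2, hr.1]
  rcases lt_or_eq_of_le (show p ^ 2 * r ≤ g₂ by linarith [hc1, hc2]) with hlt | heq
  · -- generic case: divide the mixture identity
    have hden : 0 < g₂ - p ^ 2 * r := sub_pos.2 hlt
    have h1 : (g₂ - p * r) * x ≤ (g₂ - p * r) * TU := mul_le_mul_of_nonneg_left hfarU hc1
    have h2 : (p * r - p ^ 2 * r) * x ≤ (p * r - p ^ 2 * r) * TB := mul_le_mul_of_nonneg_left hfarB hc2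
    have h3 : (g₂ - p ^ 2 * r) * x ≤ (g₂ - p ^ 2 * r) * H := by
      rw [key]
      have : (g₂ - p ^ 2 * r) * x = (g₂ - p * r) * x + (p * r - p ^ 2 * r) * x := by ring
      rw [this]
      exact add_le_add h1 h2
    exact le_of_mul_le_mul_left h3 hden
  · -- degenerate case `g₂ = p²r`: then `p = 0` (excluded by the floor) or `p = r = 1`
    have hp1 : p = 1 ∧ r = 1 := by
      have hPp : 0 < P * (p * r) := hx0.trans_le hhair
      have hp0 : 0 < p := by
        rcases hp.1.lt_or_eq with h | h; · exact h
        exfalso; rw [← h, zero_mul, mul_zero] at hPp; exact lt_irrefl _ hPp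
      -- `p(1+r)/2 = p² r` with `0 < p ≤ 1`, `0 < r ≤ 1` forces `p = r = 1`
      have h0 : p ^ 2 * r = p * (1 + r) / 2 := by rw [← hg₂]; exact heq
      have h1 : p + p * r = 2 * (p ^ 2 * r) := by linear_combination (-2 : ℝ) * h0
      have k1 : p ^ 2 * r ≤ p * r :=
        calc p ^ 2 * r = p * (p * r) := by ring
          _ ≤ 1 * (p * r) := mul_le_mul_of_nonneg_right hp.2 (mul_nonneg hp.1 hr.1)
          _ = p * r := one_mul _
      have k2 : p - p * r ≤ 0 := by linarith only [h1, k1]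
      have hr1 : r = 1 := by
        by_contra hcon
        have hlt1 : r < 1 := lt_of_le_of_ne hr.2 hcon
        have hpos : 0 < p * (1 - r) := mul_pos hp0 (by linarith only [hlt1])
        have hexp : p - p * r = p * (1 - r) := by ring
        linarith only [k2, hpos, hexp]
      subst hr1
      have k3 : p * (1 - p) = 0 := by linear_combination (1 / 2 : ℝ) * h1
      rcases mul_eq_zero.1 k3 with h | h
      · exact absurd h hp0.ne'
      · exact ⟨by linarith only [h], rfl⟩
    obtain ⟨rfl, rfl⟩ := hp1
    have hg₂1 : g₂ = 1 := by rw [hg₂]; norm_num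
    have hTB2 : TB = T2 := by rw [heB, hg₂1]; ring
    have hHT : H = T2 := by rw [hH]; ring
    rw [hHT, ← hTB2]
    exact hfarB

end BlockComb

end Quant

end Summit.CriticalPhenomena.PercolationContinuityZ3.Theorems
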